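import Mathlib
import Literature.Analysis.FluidPDE.StretchedLayerNS
import Summits.AnomalousDissipation.AnomalousDissipation.Theses.MarginalStabilityChain
import HarnessLib

/-!
# `StretchedVortexRows` as filed: closure through the `ℝ≥0∞` loophole (potential-flow witness)

Line `potential-flow-essential-singularity` for crux `stmt-AnomalousDissipation-3009`
(`MarginalStabilityChain.StretchedVortexRows`), lead skeleton.

The crux AS FILED asks, for every period `L > 0` and every small `ν > 0`, for a steady classical
`L`-periodic member `(u, v, p)` of the stretched two-dimensional Navier–Stokes class with the
shear far field `u → ±1/2`, `v → 0` as `y → ±∞` **pointwise in `x`**, whose dissipation per unit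
area, an EXTENDED real `(ν/L)∫⁻∫⁻ |∇(u,v)|² ∈ [0, ∞]`, is `≥ c·min(L,1)`.  The standing disprover's
file (`Cruxes/StretchedVortexRows/Disproof.lean`, §1 `stretchedVortexRows_of_infinite_witnesses`)
records that a class member with INFINITE Dirichlet integral witnesses the bound for every `c`.
This line constructs such a member explicitly, for every `L > 0` and EVERY `ν`:

* an IRROTATIONAL (potential) member: `u - iv = Φ(x + iy)` with `Φ` ENTIRE and `L`-periodic; then
  `Δu = Δv = 0`, `∂ₓu + ∂_yv = 0`, `∂_yu = ∂ₓv`, and with `p = -(u² + v²)/2 + y v` both momentum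
  equations hold identically (Bernoulli for the potential flow `(u, v - y, z)` of 3-D NS), for
  any viscosity (`stub_potentialFlow`);
* the far field `Φ(x + iy) → ±1/2` as `y → ±∞` for every fixed `x` forces, by Liouville on the
  cylinder, an ESSENTIAL singularity: writing `Φ = G(w)`, `w = e^{-2πiz/L}`, we take
  `G(w) = 1/2 - (N(c + w) - N(c))/(w N'(c))` where `N(z) = ∫_ℝ exp(z eᵗ - t eᵗ + t) dt`
  (`= ∫₀^∞ e^{zs} s^{-s} ds`, D. J. Newman's entire function bounded on every ray off the positive
  real axis, Amer. Math. Monthly 83 (1976) 192–193): `N` is entire (`stub_newmanDifferentiable`),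
  the line of integration may be shifted to `Im t = φ`, `|φ| < π/2` (`stub_newmanRotate`), which
  bounds `N` by `e^{1/e}` far out on every ray issued from a point `c` with `Im c = 4`
  (`stub_newmanRayBound`); hence `G(w) → 1/2` as `|w| → ∞` along rays and `G(w) → -1/2` as `w → 0`
  (`stub_farField`), i.e. the far field holds pointwise in `x` — and only pointwise;
* on the real axis `N(T) ≥ e^T/8`, so `|Φ|` is unbounded on every far horizontal line `y = Y` at the
  point where `c + w` is real positive, while `Φ(L/2 + iY)` stays bounded
  (`stub_newmanGrowthPoints`); by the mean-square inequality on `[x(Y), L/2]` the `x`-integral of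
  `|Φ'|² ≤ |∇u|² + |∇v|²` is `≥ 1` for all large `Y`, so the Dirichlet integral over the period strip
  is `+∞` (`stub_dissipationTop`) and the `ℝ≥0∞` inequality of the crux holds for `c = 1`.

So the statement closes for the wrong physical reason: the witness is a potential flow of infinite
energy with an essential singularity at `y = ±∞`, admitted because the far field is pointwise and
the dissipation is not required finite.  The planner's repair is Disproof §6 (`layerDissipation < ⊤`
+ Gaussian vorticity decay), under which this witness disappears.

Stubs (registered): `stub_newmanDifferentiable`, `stub_newmanRotate`, `stub_newmanRayBound`,
`stub_newmanGrowthPoints`, `stub_potentialFlow`, `stub_farField`, `stub_dissipationTop`.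
Sorry-free here: the nondegeneracy `∃ c, Im c = 4 ∧ N'(c) ≠ 0` (identity theorem), the typed
bridge (Disproof §0/§1, re-proved), and the composition `StretchedVortexRows_of`.
-/

-- summit and problem are both named `AnomalousDissipation`, so every name repeats the component
set_option linter.dupNamespace false

noncomputable section

open scoped Topology ENNReal Real
open Filter Set Function MeasureTheory Complex

namespace Summit.AnomalousDissipation.AnomalousDissipation.Theorems
namespace MarginalStabilityChainStretchedVortexRows
namespace PotentialFlow

open Literature.Analysis.FluidPDE Literature.Analysis.FluidPDE.StretchedLayer
open Summit.AnomalousDissipation.AnomalousDissipation.Theses.MarginalStabilityChain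

/-! ## §1 Newman's entire function: the four analytic stubs -/

/-- **Stub 1.** Newman's function `N(z) = ∫_ℝ exp(z eᵗ - t eᵗ + t) dt` is entire
(differentiation under the integral sign, dominated on balls); D. J. Newman, Amer. Math. Monthly 83
(1976) 192–193. [folklore] -/
theorem stub_newmanDifferentiable :
    Differentiable ℂ (fun z : ℂ => ∫ τ : ℝ,
      Complex.exp (z * Complex.exp (τ : ℂ) - (τ : ℂ) * Complex.exp (τ : ℂ) + (τ : ℂ))) := by
  sorry

/-- **Stub 2.** Shift of the line of integration: for `|φ| < π/2` and every `z`,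
`∫_ℝ K(z, t) dt = ∫_ℝ K(z, t + iφ) dt` for the entire kernel `K(z, ζ) = exp(z e^ζ - ζ e^ζ + ζ)`
(Cauchy–Goursat on the rectangles `[-R, R] × [0, φ]`, whose vertical sides vanish as `R → ∞`:
`|K(z, τ + iψ)| = exp(e^τ((Re z - τ) cos ψ - (Im z - ψ) sin ψ) + τ)`). In the variable
`s = eᵗ` this is the rotation of the ray of integration of `∫₀^∞ e^{zs} s^{-s} ds`. [folklore] -/
theorem stub_newmanRotate (φ : ℝ) (hφ : φ ∈ Set.Ioo (-(π / 2)) (π / 2)) (z : ℂ) :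
    (∫ τ : ℝ, Complex.exp (z * Complex.exp (τ : ℂ) - (τ : ℂ) * Complex.exp (τ : ℂ) + (τ : ℂ))) =
      ∫ τ : ℝ, Complex.exp (z * Complex.exp ((τ : ℂ) + φ * I) -
        ((τ : ℂ) + φ * I) * Complex.exp ((τ : ℂ) + φ * I) + ((τ : ℂ) + φ * I)) := by
  sorry

/-- **Stub 3.** Ray bound. If `N` admits the shifted representations of Stub 2, then from every
base point `c` with `Im c = 4`, along every ray `c + R e^{iθ}`, eventually `‖N‖ ≤ e^{1/e}`:
on the line `Im t = φ` the kernel has modulus `exp(e^τ(A - τ cos φ) + τ) ≤ e^{1/e} exp(-a e^τ + τ)`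
when `A := Re z cos φ - (Im z - φ) sin φ ≤ -a < 0`, and `∫ exp(-a e^τ + τ) dτ = 1/a`; for
`θ ∉ 2πℤ` a fixed `φ` with `cos(θ + φ) < 0` works, for `θ ∈ 2πℤ` take `φ ↑ π/2` with
`cos φ ≤ 1/(Re c + R)` (this is where `Im c = 4 > π/2 + 1` is used). [folklore] -/
theorem stub_newmanRayBound (N : ℂ → ℂ)
    (hrot : ∀ φ : ℝ, φ ∈ Set.Ioo (-(π / 2)) (π / 2) → ∀ z : ℂ,
      N z = ∫ τ : ℝ, Complex.exp (z * Complex.exp ((τ : ℂ) + φ * I) -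
        ((τ : ℂ) + φ * I) * Complex.exp ((τ : ℂ) + φ * I) + ((τ : ℂ) + φ * I)))
    (c : ℂ) (hc : c.im = 4) (θ : ℝ) :
    ∃ R₀ : ℝ, ∀ R : ℝ, R₀ ≤ R →
      ‖N (c + R * Complex.exp (θ * I))‖ ≤ Real.exp (Real.exp (-1)) := by
  sorry

/-- **Stub 4.** Real-axis growth and its two consequences for `E_c(w) = (N(c + w) - N(c))/w`
at `w = e^{-ik(x+iy)}`, `k = 2π/L`: (i) `N 0 ≠ N 1` (`N` is real and strictly increasing on `ℝ`);
(ii) at `x = L/2` (`w = -e^{ky}`, `c + w` on the leftward horizontal ray, where `|N| ≤ N(Re c)`)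
`E_c` is bounded for `y ≥ 0`; (iii) if `Im c = 4`, for every `M` and all large `y` there is
`x ∈ (0, L/2)` (namely `kx = arcsin(4e^{-ky})`, making `c + w = T` real, `T ≍ e^{ky}`) with
`|E_c(w)| ≥ M`, because `N(T) ≥ ∫_{[0, log 2]} ≥ e^T/8`. [folklore] -/
theorem stub_newmanGrowthPoints (N : ℂ → ℂ)
    (hN : ∀ z : ℂ, N z = ∫ τ : ℝ,
      Complex.exp (z * Complex.exp (τ : ℂ) - (τ : ℂ) * Complex.exp (τ : ℂ) + (τ : ℂ))) :
    N 0 ≠ N 1 ∧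
    (∀ (c : ℂ) (L : ℝ), 0 < L → ∃ B : ℝ, ∀ y : ℝ, 0 ≤ y →
      ‖(N (c + Complex.exp (-(((2 * π / L : ℝ) : ℂ) * (((L / 2 : ℝ) : ℂ) + (y : ℂ) * I) * I))) - N c) *
        Complex.exp (((2 * π / L : ℝ) : ℂ) * (((L / 2 : ℝ) : ℂ) + (y : ℂ) * I) * I)‖ ≤ B) ∧
    (∀ c : ℂ, c.im = 4 → ∀ L : ℝ, 0 < L → ∀ M : ℝ, ∃ Y : ℝ, ∀ y : ℝ, Y ≤ y →
      ∃ x : ℝ, x ∈ Set.Ioo 0 (L / 2) ∧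
        M ≤ ‖(N (c + Complex.exp (-(((2 * π / L : ℝ) : ℂ) * ((x : ℂ) + (y : ℂ) * I) * I))) - N c) *
          Complex.exp (((2 * π / L : ℝ) : ℂ) * ((x : ℂ) + (y : ℂ) * I) * I)‖) := by
  sorry

/-! ## §2 Potential flows in the stretched class: three generic stubs -/

/-- **Stub 5.** An ENTIRE `L`-periodic complex velocity `Φ = u - iv` with the pointwise far field
`Φ(x + iy) → ±1/2` (`y → ±∞`) gives a steady member of the stretched class for every viscosity:
`u = Re Φ`, `v = -Im Φ` are harmonic conjugates (`Δu = Δv = 0`, `∂ₓu + ∂_yv = 0`, `∂_yu = ∂ₓv`),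
and `p = -(u² + v²)/2 + y v` balances both momentum equations identically; also the slice
derivatives `∂ₓu = Re Φ'`, `∂ₓv = -Im Φ'`. [folklore] -/
theorem stub_potentialFlow (Φ : ℂ → ℂ) (hΦ : Differentiable ℂ Φ) (ν L : ℝ)
    (hper : ∀ z : ℂ, Φ (z + L) = Φ z)
    (htop : ∀ x : ℝ, Tendsto (fun y : ℝ => Φ ((x : ℂ) + (y : ℂ) * I)) atTop (𝓝 (1 / 2)))
    (hbot : ∀ x : ℝ, Tendsto (fun y : ℝ => Φ ((x : ℂ) + (y : ℂ) * I)) atBot (𝓝 (-(1 / 2)))) :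
    IsSteadyStretchedLayerNSSolution ν 1 1 L
        (fun x y => (Φ ((x : ℂ) + (y : ℂ) * I)).re)
        (fun x y => -(Φ ((x : ℂ) + (y : ℂ) * I)).im)
        (fun x y => -((Φ ((x : ℂ) + (y : ℂ) * I)).re ^ 2 + (Φ ((x : ℂ) + (y : ℂ) * I)).im ^ 2) / 2 +
          y * (-(Φ ((x : ℂ) + (y : ℂ) * I)).im)) ∧
      (∀ x y : ℝ, dX (fun x y => (Φ ((x : ℂ) + (y : ℂ) * I)).re) x y =
        (deriv Φ ((x : ℂ) + (y : ℂ) * I)).re) ∧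
      (∀ x y : ℝ, dX (fun x y => -(Φ ((x : ℂ) + (y : ℂ) * I)).im) x y =
        -(deriv Φ ((x : ℂ) + (y : ℂ) * I)).im) := by
  sorry

/-- **Stub 6.** Far field of `Φ(z) = 1/2 - (N(c + w) - N(c)) w⁻¹ / N'(c)`, `w = e^{-ikz}`,
`k = 2π/L`: for fixed `x`, `w = e^{ky} e^{-ikx}` runs OUT along the ray of angle `-kx` as `y → +∞`
(there `N(c + w)` is eventually bounded by `K`, so `Φ → 1/2`) and IN to `0` as `y → -∞`
(difference quotient `→ N'(c)`, so `Φ → 1/2 - 1`). [folklore] -/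
theorem stub_farField (N : ℂ → ℂ) (hN : Differentiable ℂ N) (c : ℂ) (hκ : deriv N c ≠ 0) (K : ℝ)
    (hray : ∀ θ : ℝ, ∃ R₀ : ℝ, ∀ R : ℝ, R₀ ≤ R → ‖N (c + R * Complex.exp (θ * I))‖ ≤ K)
    (L : ℝ) (hL : 0 < L) :
    (∀ x : ℝ, Tendsto (fun y : ℝ => (1 / 2 : ℂ) -
        (N (c + Complex.exp (-(((2 * π / L : ℝ) : ℂ) * ((x : ℂ) + (y : ℂ) * I) * I))) - N c) *
          Complex.exp (((2 * π / L : ℝ) : ℂ) * ((x : ℂ) + (y : ℂ) * I) * I) / deriv N c)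
        atTop (𝓝 (1 / 2))) ∧
    (∀ x : ℝ, Tendsto (fun y : ℝ => (1 / 2 : ℂ) -
        (N (c + Complex.exp (-(((2 * π / L : ℝ) : ℂ) * ((x : ℂ) + (y : ℂ) * I) * I))) - N c) *
          Complex.exp (((2 * π / L : ℝ) : ℂ) * ((x : ℂ) + (y : ℂ) * I) * I) / deriv N c)
        atBot (𝓝 (-(1 / 2)))) := by
  sorry

/-- **Stub 7.** Infinite Dirichlet integral from two-point data on far horizontal lines: if an
entire `Φ` is bounded at `x = L/2` for `y ≥ 0` but unbounded inside `(0, L/2)` as `y → +∞`, then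
`∫⁻_{x ∈ (0,L]} ∫⁻_y |Φ'(x+iy)|² = ⊤` — mean square on `[x(y), L/2]`:
`∫ |Φ'|² dx ≥ |Φ(L/2+iy) - Φ(x(y)+iy)|²/(L/2) ≥ 1` for `y ≥ Y`, then Tonelli. [folklore] -/
theorem stub_dissipationTop (Φ : ℂ → ℂ) (hΦ : Differentiable ℂ Φ) (L : ℝ) (hL : 0 < L) (B : ℝ)
    (hB : ∀ y : ℝ, 0 ≤ y → ‖Φ (((L / 2 : ℝ) : ℂ) + (y : ℂ) * I)‖ ≤ B)
    (hM : ∀ M : ℝ, ∃ Y : ℝ, ∀ y : ℝ, Y ≤ y →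
      ∃ x : ℝ, x ∈ Set.Ioo 0 (L / 2) ∧ M ≤ ‖Φ ((x : ℂ) + (y : ℂ) * I)‖) :
    (∫⁻ x in Ioc 0 L, ∫⁻ y : ℝ, ENNReal.ofReal (‖deriv Φ ((x : ℂ) + (y : ℂ) * I)‖ ^ 2)) = ⊤ := by
  sorry

/-! ## §3 Glue proved here -/

/-- Newman's kernel `K(z, ζ) = exp(z e^ζ - ζ e^ζ + ζ)` (abbreviation used only in this file's
glue; the stubs spell it out). [folklore] -/
def newmanKernel (z ζ : ℂ) : ℂ := Complex.exp (z * Complex.exp ζ - ζ * Complex.exp ζ + ζ)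

/-- Newman's entire function `N(z) = ∫_ℝ K(z, t) dt = ∫₀^∞ e^{zs} s^{-s} ds` (D. J. Newman, Amer.
Math. Monthly 83 (1976) 192–193). [folklore] -/
def newman (z : ℂ) : ℂ := ∫ τ : ℝ, newmanKernel z τ

/-- Unfolding `newman`. [folklore] -/
theorem newman_eq (z : ℂ) : newman z = ∫ τ : ℝ,
    Complex.exp (z * Complex.exp (τ : ℂ) - (τ : ℂ) * Complex.exp (τ : ℂ) + (τ : ℂ)) := rfl

/-- `N` is entire (Stub 1). [folklore] -/
theorem differentiable_newman : Differentiable ℂ newman := stub_newmanDifferentiable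

/-- **Nondegeneracy** (identity theorem): an entire function with `F 0 ≠ F 1` has a point on the
line `Im = 4` where `F' ≠ 0` — otherwise `F'`, analytic and vanishing on a set accumulating at `4i`,
vanishes identically and `F` is constant. [folklore] -/
theorem exists_deriv_ne_zero_of_ne (F : ℂ → ℂ) (hF : Differentiable ℂ F) (h01 : F 0 ≠ F 1) :
    ∃ c : ℂ, c.im = 4 ∧ deriv F c ≠ 0 := by
  by_contra hcon
  push Not at hcon
  have hA0 : AnalyticOnNhd ℂ F univ := fun z _ => hF.analyticAt z
  have hA : AnalyticOnNhd ℂ (deriv F) univ := hA0.deriv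
  -- `deriv F` vanishes frequently near `4 I` (along the horizontal line through it)
  have hfreq : ∃ᶠ z in 𝓝[≠] ((4 : ℂ) * I), deriv F z = 0 := by
    have ht : Tendsto (fun t : ℝ => (t : ℂ) + 4 * I) (𝓝[≠] 0) (𝓝[≠] ((4 : ℂ) * I)) := by
      refine tendsto_nhdsWithin_of_tendsto_nhds_of_eventually_within _ ?_ ?_
      · have : Continuous fun t : ℝ => (t : ℂ) + 4 * I := by fun_prop
        simpa using (this.tendsto 0).mono_left nhdsWithin_le_nhds
      · filter_upwards [self_mem_nhdsWithin] with t ht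
        simp only [mem_compl_iff, mem_singleton_iff, add_eq_right, ofReal_eq_zero]
        exact ht
    refine ht.frequently (Eventually.frequently (Eventually.of_forall fun t => ?_))
    exact hcon _ (by simp)
  have hzero : EqOn (deriv F) 0 univ :=
    hA.eqOn_zero_of_preconnected_of_frequently_eq_zero isPreconnected_univ (mem_univ _) hfreq
  exact h01 (is_const_of_deriv_eq_zero hF (fun x => hzero (mem_univ x)) 0 1)

/-! ## §4 The typed bridge (Disproof §0–§1, re-proved so that this file is self-contained) -/

/-- One witness clause of the inlined crux ⇔ the typed structure plus the dissipation bound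
(adapted from `Cruxes/StretchedVortexRows/Disproof.lean`, cdisprove seat). [folklore] -/
theorem witness_iff (c L ν : ℝ) (u v p : ℝ → ℝ → ℝ) :
    (ContDiff ℝ 2 (fun q : ℝ × ℝ => u q.1 q.2) ∧ ContDiff ℝ 2 (fun q : ℝ × ℝ => v q.1 q.2) ∧
      ContDiff ℝ 1 (fun q : ℝ × ℝ => p q.1 q.2) ∧
      (∀ x y, u x y * dX u x y + (v x y - y) * dY u x y = -dX p x y + ν * (dX (dX u) x y + dY (dY u) x y) ∧
        u x y * dX v x y + (v x y - y) * dY v x y - v x y = -dY p x y + ν * (dX (dX v) x y + dY (dY v) x y) ∧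
        dX u x y + dY v x y = 0) ∧
      (∀ x y, u (x + L) y = u x y ∧ v (x + L) y = v x y ∧ p (x + L) y = p x y) ∧
      (∀ x, Tendsto (fun y => u x y) atTop (𝓝 (1 / 2)) ∧ Tendsto (fun y => u x y) atBot (𝓝 (-(1 / 2))) ∧
        Tendsto (fun y => v x y) atTop (𝓝 0) ∧ Tendsto (fun y => v x y) atBot (𝓝 0)) ∧
      ENNReal.ofReal (c * min L 1) ≤ ENNReal.ofReal (ν / L) *
        ∫⁻ x in Ioc 0 L, ∫⁻ y, ENNReal.ofReal (dX u x y ^ 2 + dY u x y ^ 2 + dX v x y ^ 2 + dY v x y ^ 2)) ↔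
    (IsSteadyStretchedLayerNSSolution ν 1 1 L u v p ∧ ENNReal.ofReal (c * min L 1) ≤ layerDissipation ν L u v) := by
  constructor
  · rintro ⟨hu, hv, hp, hpde, hper, hfar, hD⟩
    refine ⟨⟨hu, hv, hp, ?_, ?_, fun x y => (hpde x y).2.2, fun x y => (hper x y).1,
      fun x y => (hper x y).2.1, fun x y => (hper x y).2.2, ?_, ?_, fun x => (hfar x).2.2.1,
      fun x => (hfar x).2.2.2⟩, hD⟩
    · intro x y; simpa only [one_mul, lap_apply] using (hpde x y).1
    · intro x y; simpa only [one_mul, lap_apply] using (hpde x y).2.1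
    · intro x; simpa using (hfar x).1
    · intro x; simpa using (hfar x).2.1
  · rintro ⟨h, hD⟩
    refine ⟨h.contDiff_u, h.contDiff_v, h.contDiff_p, fun x y => ⟨?_, ?_, h.divFree x y⟩,
      fun x y => ⟨h.periodic_u x y, h.periodic_v x y, h.periodic_p x y⟩,
      fun x => ⟨?_, ?_, h.tendsto_v_atTop x, h.tendsto_v_atBot x⟩, hD⟩
    · simpa only [one_mul, lap_apply] using h.momentum_x x y
    · simpa only [one_mul, lap_apply] using h.momentum_y x y
    · simpa using h.tendsto_u_atTop x
    · simpa using h.tendsto_u_atBot x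

/-- **Loophole, typed form** (Disproof §1, re-proved): steady members of infinite `layerDissipation`
for every `L > 0`, `ν > 0` give `StretchedVortexRows` with `c = ν₀ = 1`. [folklore] -/
theorem stretchedVortexRows_of_infinite_witnesses
    (h : ∀ L : ℝ, 0 < L → ∀ ν : ℝ, 0 < ν →
      ∃ u v p : ℝ → ℝ → ℝ, IsSteadyStretchedLayerNSSolution ν 1 1 L u v p ∧ layerDissipation ν L u v = ⊤) :
    StretchedVortexRows := by
  refine ⟨1, one_pos, fun L hL => ⟨1, one_pos, fun ν hν _ => ?_⟩⟩
  obtain ⟨u, v, p, hsol, htop⟩ := h L hL ν hν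
  refine ⟨u, v, p, ?_⟩
  have key : IsSteadyStretchedLayerNSSolution ν 1 1 L u v p ∧
      ENNReal.ofReal (1 * min L 1) ≤ layerDissipation ν L u v := ⟨hsol, by rw [htop]; exact le_top⟩
  exact (witness_iff 1 L ν u v p).2 key

/-! ## §5 The witness and the composition -/

/-- The complex velocity `Φ = u - iv` of the witness: `Φ(z) = 1/2 - (N(c + w) - N(c)) w⁻¹ / N'(c)`,
`w = e^{-2πiz/L}` (spelled with `w⁻¹ = e^{+2πiz/L}`). [folklore] -/
def phiW (c : ℂ) (L : ℝ) (z : ℂ) : ℂ :=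
  (1 / 2 : ℂ) - (newman (c + Complex.exp (-(((2 * π / L : ℝ) : ℂ) * z * I))) - newman c) *
    Complex.exp (((2 * π / L : ℝ) : ℂ) * z * I) / deriv newman c

/-- `Φ` is entire. [folklore] -/
theorem differentiable_phiW (c : ℂ) (L : ℝ) : Differentiable ℂ (phiW c L) := by
  unfold phiW
  have h1 : Differentiable ℂ fun z : ℂ => Complex.exp (-(((2 * π / L : ℝ) : ℂ) * z * I)) := by
    fun_prop
  have h2 : Differentiable ℂ fun z : ℂ => Complex.exp (((2 * π / L : ℝ) : ℂ) * z * I) := by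
    fun_prop
  have h3 : Differentiable ℂ fun z : ℂ =>
      newman (c + Complex.exp (-(((2 * π / L : ℝ) : ℂ) * z * I))) :=
    differentiable_newman.comp (h1.const_add c)
  exact ((h3.sub_const _).mul h2).div_const _ |>.const_sub _

/-- `Φ` is `L`-periodic (`e^{∓2πi(z+L)/L} = e^{∓2πiz/L}`). [folklore] -/
theorem phiW_periodic (c : ℂ) {L : ℝ} (hL : L ≠ 0) (z : ℂ) : phiW c L (z + L) = phiW c L z := by
  have hL' : (L : ℂ) ≠ 0 := ofReal_ne_zero.2 hL
  have hk : ((2 * π / L : ℝ) : ℂ) * (L : ℂ) = 2 * π := by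
    push_cast; field_simp
  have e1 : Complex.exp (-(((2 * π / L : ℝ) : ℂ) * (z + L) * I)) =
      Complex.exp (-(((2 * π / L : ℝ) : ℂ) * z * I)) := by
    rw [show -(((2 * π / L : ℝ) : ℂ) * (z + L) * I) =
        -(((2 * π / L : ℝ) : ℂ) * z * I) + (-1 : ℤ) * (2 * π * I) by rw [mul_add, hk.symm]; push_cast; ring,
      Complex.exp_add, Complex.exp_int_mul_two_pi_mul_I, mul_one]
  have e2 : Complex.exp (((2 * π / L : ℝ) : ℂ) * (z + L) * I) =
      Complex.exp (((2 * π / L : ℝ) : ℂ) * z * I) := by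
    rw [show ((2 * π / L : ℝ) : ℂ) * (z + L) * I =
        ((2 * π / L : ℝ) : ℂ) * z * I + (1 : ℤ) * (2 * π * I) by rw [mul_add, hk.symm]; push_cast; ring,
      Complex.exp_add, Complex.exp_int_mul_two_pi_mul_I, mul_one]
  unfold phiW
  rw [e1, e2]

/-- The witness fields: `u = Re Φ`, `v = -Im Φ`, `p = -(u² + v²)/2 + y v`. [folklore] -/
def uW (c : ℂ) (L : ℝ) (x y : ℝ) : ℝ := (phiW c L ((x : ℂ) + (y : ℂ) * I)).re

/-- See `uW`. [folklore] -/
def vW (c : ℂ) (L : ℝ) (x y : ℝ) : ℝ := -(phiW c L ((x : ℂ) + (y : ℂ) * I)).im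

/-- See `uW`. [folklore] -/
def pW (c : ℂ) (L : ℝ) (x y : ℝ) : ℝ :=
  -((phiW c L ((x : ℂ) + (y : ℂ) * I)).re ^ 2 + (phiW c L ((x : ℂ) + (y : ℂ) * I)).im ^ 2) / 2 +
    y * (-(phiW c L ((x : ℂ) + (y : ℂ) * I)).im)

/-- For every `L > 0` there is, for EVERY `ν`, a steady member of the stretched class with
`u → ±1/2`, `v → 0` pointwise and `layerDissipation = ⊤` (for `ν > 0`). [folklore] -/
theorem exists_infinite_witness (L : ℝ) (hL : 0 < L) (ν : ℝ) (hν : 0 < ν) :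
    ∃ u v p : ℝ → ℝ → ℝ, IsSteadyStretchedLayerNSSolution ν 1 1 L u v p ∧ layerDissipation ν L u v = ⊤ := by
  -- the base point `c`, `Im c = 4`, `N'(c) ≠ 0`
  obtain ⟨h01, hbounded, hgrowth⟩ := stub_newmanGrowthPoints newman newman_eq
  obtain ⟨c, hc, hκ⟩ := exists_deriv_ne_zero_of_ne newman differentiable_newman h01
  -- ray bound from the shifted representations
  have hray : ∀ θ : ℝ, ∃ R₀ : ℝ, ∀ R : ℝ, R₀ ≤ R →
      ‖newman (c + R * Complex.exp (θ * I))‖ ≤ Real.exp (Real.exp (-1)) :=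
    stub_newmanRayBound newman (fun φ hφ z => by rw [newman_eq]; exact stub_newmanRotate φ hφ z) c hc
  -- far field of `Φ`
  obtain ⟨htop, hbot⟩ := stub_farField newman differentiable_newman c hκ _ hray L hL
  have htop' : ∀ x : ℝ, Tendsto (fun y : ℝ => phiW c L ((x : ℂ) + (y : ℂ) * I)) atTop (𝓝 (1 / 2)) :=
    fun x => htop x
  have hbot' : ∀ x : ℝ, Tendsto (fun y : ℝ => phiW c L ((x : ℂ) + (y : ℂ) * I)) atBot (𝓝 (-(1 / 2))) :=
    fun x => hbot x
  -- the steady structure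
  obtain ⟨hsol, hdXu, hdXv⟩ := stub_potentialFlow (phiW c L) (differentiable_phiW c L) ν L
    (fun z => phiW_periodic c hL.ne' z) htop' hbot'
  refine ⟨uW c L, vW c L, pW c L, hsol, ?_⟩
  -- two-point data for `Φ` on far horizontal lines
  obtain ⟨B, hB⟩ := hbounded c L hL
  have hκpos : 0 < ‖deriv newman c‖ := norm_pos_iff.2 hκ
  have hB' : ∀ y : ℝ, 0 ≤ y → ‖phiW c L (((L / 2 : ℝ) : ℂ) + (y : ℂ) * I)‖ ≤ 1 / 2 + B / ‖deriv newman c‖ := by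
    intro y hy
    have h := hB y hy
    unfold phiW
    refine (norm_sub_le _ _).trans ?_
    have h12 : ‖(1 / 2 : ℂ)‖ = 1 / 2 := by norm_num
    rw [h12, norm_div]
    gcongr
  have hM' : ∀ M : ℝ, ∃ Y : ℝ, ∀ y : ℝ, Y ≤ y →
      ∃ x : ℝ, x ∈ Set.Ioo 0 (L / 2) ∧ M ≤ ‖phiW c L ((x : ℂ) + (y : ℂ) * I)‖ := by
    intro M
    obtain ⟨Y, hY⟩ := hgrowth c hc L hL ((M + 1 / 2) * ‖deriv newman c‖)
    refine ⟨Y, fun y hy => ?_⟩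
    obtain ⟨x, hx, hMx⟩ := hY y hy
    refine ⟨x, hx, ?_⟩
    have hq : M + 1 / 2 ≤ ‖(newman (c + Complex.exp (-(((2 * π / L : ℝ) : ℂ) * ((x : ℂ) + (y : ℂ) * I) * I))) -
        newman c) * Complex.exp (((2 * π / L : ℝ) : ℂ) * ((x : ℂ) + (y : ℂ) * I) * I) / deriv newman c‖ := by
      rw [norm_div, le_div_iff₀ hκpos]; exact hMx
    have : ‖(newman (c + Complex.exp (-(((2 * π / L : ℝ) : ℂ) * ((x : ℂ) + (y : ℂ) * I) * I))) -
        newman c) * Complex.exp (((2 * π / L : ℝ) : ℂ) * ((x : ℂ) + (y : ℂ) * I) * I) / deriv newman c‖ -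
        ‖(1 / 2 : ℂ)‖ ≤ ‖phiW c L ((x : ℂ) + (y : ℂ) * I)‖ := by
      unfold phiW
      rw [norm_sub_rev (1 / 2 : ℂ)]
      exact norm_sub_norm_le _ _
    have h12 : ‖(1 / 2 : ℂ)‖ = 1 / 2 := by norm_num
    linarith
  have htopI := stub_dissipationTop (phiW c L) (differentiable_phiW c L) L hL _ hB' hM'
  -- compare the Dirichlet integrand with `|Φ'|² = (∂ₓu)² + (∂ₓv)²`
  rw [layerDissipation_def]
  have hle : (∫⁻ x in Ioc 0 L, ∫⁻ y : ℝ, ENNReal.ofReal (‖deriv (phiW c L) ((x : ℂ) + (y : ℂ) * I)‖ ^ 2)) ≤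
      ∫⁻ x in Ioc 0 L, ∫⁻ y, ENNReal.ofReal (dX (uW c L) x y ^ 2 + dY (uW c L) x y ^ 2 +
        dX (vW c L) x y ^ 2 + dY (vW c L) x y ^ 2) := by
    refine lintegral_mono fun x => lintegral_mono fun y => ENNReal.ofReal_le_ofReal ?_
    have hu : dX (uW c L) x y = (deriv (phiW c L) ((x : ℂ) + (y : ℂ) * I)).re := hdXu x y
    have hv : dX (vW c L) x y = -(deriv (phiW c L) ((x : ℂ) + (y : ℂ) * I)).im := hdXv x y
    rw [hu, hv, ← Complex.normSq_eq_norm_sq, Complex.normSq_apply]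
    nlinarith [sq_nonneg (dY (uW c L) x y), sq_nonneg (dY (vW c L) x y)]
  have htop2 : (∫⁻ x in Ioc 0 L, ∫⁻ y, ENNReal.ofReal (dX (uW c L) x y ^ 2 + dY (uW c L) x y ^ 2 +
      dX (vW c L) x y ^ 2 + dY (vW c L) x y ^ 2)) = ⊤ := eq_top_iff.2 (htopI ▸ hle)
  rw [htop2, ENNReal.mul_top (by simpa using div_pos hν hL)]

/-- **Composition.** The seven stubs close the crux as filed. [folklore] -/
theorem StretchedVortexRows_of : StretchedVortexRows :=
  stretchedVortexRows_of_infinite_witnesses fun L hL ν hν => exists_infinite_witness L hL ν hν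

end PotentialFlow
end MarginalStabilityChainStretchedVortexRows
end Summit.AnomalousDissipation.AnomalousDissipation.Theorems
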